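import Mathlib
import Summits.Ventures.FusionMHD.Bench.BallooningSAlphaConicS025
import Summits.Ventures.FusionMHD.Bench.BallooningSAlphaConicS05
import Summits.Ventures.FusionMHD.Bench.BallooningSAlphaConicS15
import Summits.Ventures.FusionMHD.Bench.BallooningSAlphaConicS3
import Literature.MathematicalPhysics.MHD.BallooningSAlphaStableSide
import HarnessLib

/-!
# F3 — THREE CERTIFIED CONICS COVER THE UPPER PART OF THE `s–α` MODEL'S UNSTABLE BAND FOR `1/2 ≤ s ≤ 4`, UP TO WITHIN `0.06` OF THE
# SECOND-STABILITY EDGE: a statement UNIFORM IN THE SHEAR — every `(s, α)` in the union of the three certified quadrilaterals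
# `Q₁ = {1/2 ≤ s ≤ 1, 3s/10 + 43/100 ≤ α ≤ 171s/100 + 33/40}`, `Q₂ = {1 ≤ s ≤ 2, 101s/200 + 81/200 ≤ α ≤ 79s/50 + 1}`,
# `Q₃ = {2 ≤ s ≤ 4, 7s/10 + 3/20 ≤ α ≤ 7s/5 + 27/20}` carries an instability witness
(venture LADDER-GRIDFUSION, rung F3; cell `gridfusion`, typed by gridfusion-lit-3 (g14), 2026-08-28.  ONE composition file over the conic files
`BallooningSAlphaConicS05 / S15 / S3` (+ `S025`, low shear, `unstable_of_mem_quads₄`) (each: one finite-element trial function, five kernel-enclosed coefficients of `W(s, α) = F₀ + A s² + B sα + C α² + E α`,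
engine `Literature/MathematicalPhysics/MHD/BallooningSAlphaSplineConic.lean`); 0 `def … : Prop` facts, 0 defs, 0 kit, no `decide` here, no
`native_decide`, no floating point in any statement.)

## THREE COLUMNS
CERTIFIED (kernel): in the `s–α` ballooning MODEL (Freidberg (12.96)–(12.99), `Λ = sθ − α sin θ`, `θ₀ = 0`): `unstable_of_mem_quads` — for every real
`(s, α)` in `Q₁ ∪ Q₂ ∪ Q₃` SOME window carries an explicit differentiable trial function vanishing at its ends with NEGATIVE one-surface energy
(the `[−16, 16]` spline `SAlphaS05W157` on `Q₁`, the `[−6, 6]` splines `SAlphaS15W33` on `Q₂` and `SAlphaS3W55` on `Q₃`); the upper polyline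
`171s/100 + 33/40 ∣ 79s/50 + 1 ∣ 7s/5 + 27/20` runs from `(1/2, 1.68)` to `(4, 6.95)`.  VALIDATED (not in the kernel; lit-3 `edges.py` shooting): the
model's second edge `α₂(s) ≈ 1.685, 2.165, 2.604, 3.019, 3.417, 3.802, 4.178, 4.907, 5.614, 6.304, 6.981` at `s = 1/2, 3/4, 1, 5/4, 3/2, 7/4, 2, 5/2, 3,
7/2, 4`; the upper polyline sits `0.005–0.07` below it (chords of the conics' concave upper branches; the conics themselves are within `0.03`
except near `s = 1`); the lower polyline `(1/2, 0.58) → (1, 0.73) ∣ (1, 0.91) → (2, 1.415) ∣ (2, 1.55) → (4, 2.95)` lies inside the band, above the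
first edge (model-7's lens `[lensLo s, lensHi s]`, `1/2 ≤ s ≤ 3`, covers the part below it down to `lensLo`).  MODELLED: `s–α` model
(large-aspect-ratio shifted circles, high-`n` ballooning ordering, `θ₀ = 0`, ideal MHD); «unstable» in the model's one-surface (Newcomb) sense;
representation step (Connor–Hastie–Taylor 1979) quoted in `BallooningSAlpha.lean`, not typed; no device, no `β`-limit.  Citations: Freidberg 2014
§12.3 (12.38)–(12.40), §12.6.2 (12.97), Fig. 12.5 / (12.100) [Freidberg2014]; Fundamenski 2009 §4 (4.158)–(4.159), p0171 [Fundamenski2009].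
-/

open Set Real
open Literature.MathematicalPhysics.MHD.Ballooning Literature.MathematicalPhysics.MHD.Ballooning.SAlpha

namespace Summit.Ventures.FusionMHD.Bench

namespace SAlphaSecondEdgeConics

/-- ★★ THE UNION OF THE THREE QUADRILATERALS is on the unstable side of the MODEL, uniformly in `(s, α)`.
[cite: Freidberg2014, §12.3 eqs. (12.38)–(12.40)] («… the plasma is unstable», for a two-dimensional region of the `s–α` plane) -/
theorem unstable_of_mem_quads {s α : ℝ}
    (h : (1 / 2 ≤ s ∧ s ≤ 1 ∧ (3 / 10) * s + (43 / 100) ≤ α ∧ α ≤ (171 / 100) * s + (33 / 40)) ∨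
      (1 ≤ s ∧ s ≤ 2 ∧ (101 / 200) * s + (81 / 200) ≤ α ∧ α ≤ (79 / 50) * s + 1) ∨
      (2 ≤ s ∧ s ≤ 4 ∧ (7 / 10) * s + (3 / 20) ≤ α ∧ α ≤ (7 / 5) * s + (27 / 20))) :
    ∃ a b : ℝ, ∃ X X' : ℝ → ℝ, UnstableWitness s α a b X X' := by
  rcases h with ⟨h1, h2, h3, h4⟩ | ⟨h1, h2, h3, h4⟩ | ⟨h1, h2, h3, h4⟩
  · exact ⟨_, _, _, _, SAlphaS05W157.unstableWitness_quad h1 h2 h3 h4⟩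
  · exact ⟨_, _, _, _, SAlphaS15W33.unstableWitness_quad h1 h2 h3 h4⟩
  · exact ⟨_, _, _, _, SAlphaS3W55.unstableWitness_quad h1 h2 h3 h4⟩

/-- THE UPPER POLYLINE ITSELF (the certified curve nearest the second edge): for every `s ∈ [1/2, 4]` the surface on the polyline is unstable.
[cite: Freidberg2014, §12.3 eqs. (12.38)–(12.40)] -/
theorem unstable_on_upper_polyline {s : ℝ} (h1 : 1 / 2 ≤ s) (h2 : s ≤ 4) :
    ∃ α : ℝ, ((s ≤ 1 ∧ α = (171 / 100) * s + (33 / 40)) ∨ (1 < s ∧ s ≤ 2 ∧ α = (79 / 50) * s + 1) ∨ (2 < s ∧ α = (7 / 5) * s + (27 / 20))) ∧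
      ∃ a b : ℝ, ∃ X X' : ℝ → ℝ, UnstableWitness s α a b X X' := by
  by_cases hs1 : s ≤ 1
  · exact ⟨_, Or.inl ⟨hs1, rfl⟩, _, _, _, _, SAlphaS05W157.unstableWitness_upperLine h1 hs1⟩
  · by_cases hs2 : s ≤ 2
    · exact ⟨_, Or.inr (Or.inl ⟨not_le.mp hs1, hs2, rfl⟩), _, _, _, _,
        SAlphaS15W33.unstableWitness_upperLine (le_of_lt (not_le.mp hs1)) hs2⟩
    · exact ⟨_, Or.inr (Or.inr ⟨not_le.mp hs2, rfl⟩), _, _, _, _,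
        SAlphaS3W55.unstableWitness_upperLine (le_of_lt (not_le.mp hs2)) h2⟩

/-- … hence no point of the three quadrilaterals is on the stable side. [cite: Freidberg2014, §12.3 eq. (12.40)] -/
theorem not_stableSide_of_mem_quads {s α : ℝ}
    (h : (1 / 2 ≤ s ∧ s ≤ 1 ∧ (3 / 10) * s + (43 / 100) ≤ α ∧ α ≤ (171 / 100) * s + (33 / 40)) ∨
      (1 ≤ s ∧ s ≤ 2 ∧ (101 / 200) * s + (81 / 200) ≤ α ∧ α ≤ (79 / 50) * s + 1) ∨
      (2 ≤ s ∧ s ≤ 4 ∧ (7 / 10) * s + (3 / 20) ≤ α ∧ α ≤ (7 / 5) * s + (27 / 20))) : ¬ StableSide s α := by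
  obtain ⟨a, b, X, X', hw⟩ := unstable_of_mem_quads h
  exact fun hs => hs a b X X' hw

/-- ★★ WITH THE LOW-SHEAR CONIC (`BallooningSAlphaConicS025`, appended 2026-08-28): the union of FOUR certified quadrilaterals,
`Q₀ = {1/5 ≤ s ≤ 1/2, s/10 + 14/25 ≤ α ≤ 21s/10 + 27/50}` and `Q₁, Q₂, Q₃` above, is on the unstable side of the MODEL — a certified
two-dimensional region from `s = 1/5` to `s = 4` whose upper polyline `(1/5, 0.96) → (1/2, 1.59) ∣ (1/2, 1.68) → (1, 2.535) ∣ (1, 2.58) → (2, 4.16) ∣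
(2, 4.15) → (4, 6.95)` runs within `0.07` of the (float) second stability edge. [cite: Freidberg2014, §12.3 eqs. (12.38)–(12.40)] -/
theorem unstable_of_mem_quads₄ {s α : ℝ}
    (h : (1 / 5 ≤ s ∧ s ≤ 1 / 2 ∧ (1 / 10) * s + (14 / 25) ≤ α ∧ α ≤ (21 / 10) * s + (27 / 50)) ∨
      (1 / 2 ≤ s ∧ s ≤ 1 ∧ (3 / 10) * s + (43 / 100) ≤ α ∧ α ≤ (171 / 100) * s + (33 / 40)) ∨
      (1 ≤ s ∧ s ≤ 2 ∧ (101 / 200) * s + (81 / 200) ≤ α ∧ α ≤ (79 / 50) * s + 1) ∨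
      (2 ≤ s ∧ s ≤ 4 ∧ (7 / 10) * s + (3 / 20) ≤ α ∧ α ≤ (7 / 5) * s + (27 / 20))) :
    ∃ a b : ℝ, ∃ X X' : ℝ → ℝ, UnstableWitness s α a b X X' := by
  rcases h with ⟨h1, h2, h3, h4⟩ | h'
  · exact ⟨_, _, _, _, SAlphaS025W104.unstableWitness_quad h1 h2 h3 h4⟩
  · exact unstable_of_mem_quads h'

/-- … and no point of the four quadrilaterals is on the stable side. [cite: Freidberg2014, §12.3 eq. (12.40)] -/
theorem not_stableSide_of_mem_quads₄ {s α : ℝ}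
    (h : (1 / 5 ≤ s ∧ s ≤ 1 / 2 ∧ (1 / 10) * s + (14 / 25) ≤ α ∧ α ≤ (21 / 10) * s + (27 / 50)) ∨
      (1 / 2 ≤ s ∧ s ≤ 1 ∧ (3 / 10) * s + (43 / 100) ≤ α ∧ α ≤ (171 / 100) * s + (33 / 40)) ∨
      (1 ≤ s ∧ s ≤ 2 ∧ (101 / 200) * s + (81 / 200) ≤ α ∧ α ≤ (79 / 50) * s + 1) ∨
      (2 ≤ s ∧ s ≤ 4 ∧ (7 / 10) * s + (3 / 20) ≤ α ∧ α ≤ (7 / 5) * s + (27 / 20))) : ¬ StableSide s α := by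
  obtain ⟨a, b, X, X', hw⟩ := unstable_of_mem_quads₄ h
  exact fun hs => hs a b X X' hw

end SAlphaSecondEdgeConics

end Summit.Ventures.FusionMHD.Bench
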